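import Literature.AnabelianGeometry.SemiGraphs.PSCSeparatingCoveringsThreeChainPointed
import Literature.AnabelianGeometry.SemiGraphs.PSCSeparatingCoveringsTwoComponentUnmarkedEdgesOneCusp
import Literature.AnabelianGeometry.SemiGraphs.ProSigmaUnmarkedNodeMalnormal
import HarnessLib

/-!
# [CombGC] Prop. 1.2, proof p. 9: VERTICIAL separating coverings at THREE-COMPONENT CHAINS with an UNMARKED end component (row F-2826)

Mochizuki, *A combinatorial version of the Grothendieck conjecture*, Tohoku Math. J. **59** (2007)
[CombGC], PROOF of Proposition 1.2, p. 9: "if `v₁ ≠ v₂` …, then there exists a finite étale … covering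
`G' → G` whose restriction to the anabelioid `G_{v₂}` is trivial …, but whose restriction to `G_{v₁}` is
nontrivial" [cite: MochizukiCombGC2007, Prop 1.2 proof p.9]; typed LEVEL-WISE as
`PSCDatum.VerticialSeparatingCoverings` (abc-iut-w4-d081, row P12-L01-V; abc-iut FACT-LIST row F-2826 — a
schema whose universal closure is refuted as typed; the instance forms at genuine carriers are the content).

PROOF-ONLY file (abc-iut-f-166 gen 6, row «UNMARKED-END-CHAIN», file 2; 0 definitions).  The carrier:
abc-iut-f-164's three-component chain shape `C₀ ∪_{ν_A} C_mid ∪_{ν_B} C₁` with the LAST component UNMARKED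
(`s₁ = 0 < s₂ < r`, `g₀ ≤ g₁ < g`, `C₀` stable), over a profinite pro-`Σ` completion `ι : Γ_{g,r} → Π`.  In the
node-loop basis `b_A` of `(g₀, s₂)` (which carries `ε_A`): `Π_{v₀} = cl ι⟨b_A(S₀)⟩` and
`Π_{v₁} = cl ι⟨a_i, b_i (i ≥ g₁), η⟩ = cl ι⟨b_A(S₁)⟩` are free-factor closures (`η = (∏_{i≥g₁}[a_i,b_i])⁻¹`
lies in the handle factor of `C₁`), but the middle group is `Π_{v_mid} = cl ι⟨b_A(S_mid) ∪ {η}⟩` — a free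
factor plus the boundary word of the NEIGHBOURING factor (`closure_chainMid_unmarkedLast_eq`: the marked point
`c₀` of `C_mid` is recovered from `η = c₀ · (c₁⋯c_{s₂−1}) · ε_A · ∏_{g₀≤i<g₁}[a_i,b_i]`), exactly the CUT-OFF
shape of abc-iut-f-164's `cutoff_exists_open_separating_sameVertex` (character `Ψ = ε_A^∨`, killing every
letter of `η`).  Same-vertex pairs: fibred twist at `v₀`, `v₁`, cut-off twist at `v_mid`; cross-vertex pairs:
free-factor projections (witnesses `ε_A`, `a_{g₁}`, `η` — `η ≠ 1` by abc-iut-f-164's embedding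
`exists_hom_closedComponent`) and, for the killed middle vertex, the character dual to a letter of the alive end
component mod `ℓ^{[Π:V]}` through `exists_open_separating_of_hom` (it kills `η`, a product of commutators).

* `closure_chainMid_unmarkedLast_eq` — the middle vertex group in the basis `b_A`;
* `verticialSeparatingCoverings_of_threeChain_unmarkedEnd` — **F-2826** (`V' := V`) at EVERY such datum.

Instance forms at data of the shape of genuine stable curves: consistency evidence for the typed schema, not
the printed theorem for all pointed stable curves.  Nothing here takes a side on [IUTchIII] Cor. 3.12.
-/

noncomputable section

/-! ### The middle vertex group when the last component is unmarked -/

namespace Literature.GroupTheory.CombinatorialGroupTheory.PuncturedSurfaceGroup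

variable {g r' g₀ g₁ s₂ : ℕ} {εA η : PuncturedSurfaceGroup g (r' + 1)}
  {B : FreeGroupBasis ((Fin g × Bool) ⊕ Fin r') (PuncturedSurfaceGroup g (r' + 1))}

/-- **The middle component of a chain whose last component is unmarked**, in the node-loop basis `B` of
`(g₀, s₂)` (`B` carries `a_i`, `b_i`, the `c_{j+1}` off slot `s₂ − 1`, and `ε_A` at slot `s₂ − 1`): for
`1 ≤ s₂ ≤ r'`, `g₀ ≤ g₁`,
`⟨a_i, b_i (g₀ ≤ i < g₁), c_j (j < s₂), ε_A, η⟩ = ⟨B(S_mid) ∪ {η}⟩`, `S_mid = {(i,·) : g₀ ≤ i < g₁} ∪ {j : j+1 ≤ s₂}`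
— the marked point `c₀` is recovered from `η = c₀ (c₁⋯c_{s₂−1}) ε_A ∏_{g₀≤i<g₁}[a_i,b_i]`
(`secondLoop_eq_c_mul` with `s₁ = 0`). [cite: MochizukiSemiAnbd2006, Ex. 2.10 p.31] -/
theorem closure_chainMid_unmarkedLast_eq
    (hεA : εA = ((List.finRange (r' + 1)).map fun j : Fin (r' + 1) =>
        if s₂ ≤ (j : ℕ) then c (g := g) j else 1).prod *
      ((List.finRange g).map fun i : Fin g => if (i : ℕ) < g₀ then
        a (r := r' + 1) i * b i * (a i)⁻¹ * (b i)⁻¹ else 1).prod)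
    (hη : η = ((List.finRange (r' + 1)).map fun j : Fin (r' + 1) =>
        if 0 ≤ (j : ℕ) then c (g := g) j else 1).prod *
      ((List.finRange g).map fun i : Fin g => if (i : ℕ) < g₁ then
        a (r := r' + 1) i * b i * (a i)⁻¹ * (b i)⁻¹ else 1).prod)
    (ha : ∀ i, B (Sum.inl (i, false)) = a i) (hb : ∀ i, B (Sum.inl (i, true)) = b i)
    (hc : ∀ j : Fin r', (j : ℕ) + 1 ≠ s₂ → B (Sum.inr j) = c (Fin.succ j))
    (hA : ∀ h : s₂ - 1 < r', B (Sum.inr ⟨s₂ - 1, h⟩) = εA) (hg : g₀ ≤ g₁) (hs₂ : 1 ≤ s₂) (hsr : s₂ ≤ r') :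
    Subgroup.closure {x : PuncturedSurfaceGroup g (r' + 1) |
        (∃ i : Fin g, (g₀ ≤ (i : ℕ) ∧ (i : ℕ) < g₁) ∧ (x = a i ∨ x = b i)) ∨
          (∃ j : Fin (r' + 1), (0 ≤ (j : ℕ) ∧ (j : ℕ) < s₂) ∧ x = c j) ∨ x = εA ∨ x = η} =
      Subgroup.closure (B '' {x | Sum.elim (fun p : Fin g × Bool => g₀ ≤ (p.1 : ℕ) ∧ (p.1 : ℕ) < g₁)
        (fun j : Fin r' => (j : ℕ) + 1 ≤ s₂) x} ∪ {η}) := by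
  classical
  set Sm : Set ((Fin g × Bool) ⊕ Fin r') := {x | Sum.elim (fun p : Fin g × Bool => g₀ ≤ (p.1 : ℕ) ∧ (p.1 : ℕ) < g₁)
    (fun j : Fin r' => (j : ℕ) + 1 ≤ s₂) x} with hSm
  have hml : ∀ p : Fin g × Bool, (Sum.inl p : (Fin g × Bool) ⊕ Fin r') ∈ Sm ↔
      g₀ ≤ (p.1 : ℕ) ∧ (p.1 : ℕ) < g₁ := fun _ => Iff.rfl
  have hmr : ∀ j : Fin r', (Sum.inr j : (Fin g × Bool) ⊕ Fin r') ∈ Sm ↔ (j : ℕ) + 1 ≤ s₂ := fun _ => Iff.rfl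
  set R := Subgroup.closure (B '' Sm ∪ {η}) with hR
  have hmemR : ∀ x, x ∈ Sm → B x ∈ R := fun x hx => Subgroup.subset_closure (Or.inl ⟨x, hx, rfl⟩)
  have hηR : η ∈ R := Subgroup.subset_closure (Or.inr rfl)
  have haR : ∀ i : Fin g, g₀ ≤ (i : ℕ) → (i : ℕ) < g₁ → a (r := r' + 1) i ∈ R := fun i h1 h2 => by
    rw [← ha i]; exact hmemR _ ((hml _).mpr ⟨h1, h2⟩)
  have hbR : ∀ i : Fin g, g₀ ≤ (i : ℕ) → (i : ℕ) < g₁ → b (r := r' + 1) i ∈ R := fun i h1 h2 => by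
    rw [← hb i]; exact hmemR _ ((hml _).mpr ⟨h1, h2⟩)
  have hεR : εA ∈ R := by rw [← hA (by omega)]; exact hmemR _ ((hmr _).mpr (by simp only; omega))
  -- `c_j ∈ R` for `1 ≤ j < s₂` (basis members)
  have hcR : ∀ j : Fin (r' + 1), 1 ≤ (j : ℕ) → (j : ℕ) < s₂ → c (g := g) j ∈ R := by
    intro j hj1 hj2
    have hj0 : (j : ℕ) ≠ 0 := by omega
    have e1 : B (Sum.inr (j.pred (fun h => hj0 (by rw [h]; rfl)))) = c j := by
      rw [hc _ (by rw [Fin.val_pred]; omega), Fin.succ_pred]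
    rw [← e1]
    exact hmemR _ ((hmr _).mpr (by rw [Fin.val_pred]; omega))
  -- `c_0 ∈ R`: `η = c_0 · W`, `W ∈ R`
  have hc0R : c (g := g) ⟨0, by omega⟩ ∈ R := by
    have hW : ((List.finRange (r' + 1)).map fun j : Fin (r' + 1) =>
          if 0 + 1 ≤ (j : ℕ) ∧ (j : ℕ) < s₂ then c (g := g) j else 1).prod * εA *
        ((List.finRange g).map fun i : Fin g => if g₀ ≤ (i : ℕ) ∧ (i : ℕ) < g₁ then
          a (r := r' + 1) i * b i * (a i)⁻¹ * (b i)⁻¹ else 1).prod ∈ R :=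
      R.mul_mem (R.mul_mem (prod_map_finRange_ite_mem _ _ _ _ fun j hj => hcR j (by omega) hj.2) hεR)
        (comm_prod_ite_mem _ _ (fun i hi => haR i hi.1 hi.2) (fun i hi => hbR i hi.1 hi.2))
    have hrel := secondLoop_eq_c_mul (s₁ := 0) hεA hη hg (by omega) (by omega)
    have hc0 : c (g := g) ⟨0, by omega⟩ = η * (((List.finRange (r' + 1)).map fun j : Fin (r' + 1) =>
          if 0 + 1 ≤ (j : ℕ) ∧ (j : ℕ) < s₂ then c (g := g) j else 1).prod * εA *
        ((List.finRange g).map fun i : Fin g => if g₀ ≤ (i : ℕ) ∧ (i : ℕ) < g₁ then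
          a (r := r' + 1) i * b i * (a i)⁻¹ * (b i)⁻¹ else 1).prod)⁻¹ :=
      eq_mul_inv_of_mul_eq hrel.symm
    rw [hc0]
    exact R.mul_mem hηR (R.inv_mem hW)
  apply le_antisymm
  · rw [Subgroup.closure_le]
    rintro x (⟨i, ⟨h1, h2⟩, rfl | rfl⟩ | ⟨j, ⟨-, hj⟩, rfl⟩ | rfl | rfl)
    · exact haR i h1 h2
    · exact hbR i h1 h2
    · by_cases hj0 : (j : ℕ) = 0
      · have : j = ⟨0, by omega⟩ := Fin.ext hj0
        rw [this]; exact hc0R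
      · exact hcR j (by omega) hj
    · exact hεR
    · exact hηR
  · rw [Subgroup.closure_le]
    rintro x (⟨y, hy, rfl⟩ | rfl)
    · apply Subgroup.subset_closure
      rcases y with ⟨i, _ | _⟩ | j
      · exact Or.inl ⟨i, (hml _).mp hy, Or.inl (ha i)⟩
      · exact Or.inl ⟨i, (hml _).mp hy, Or.inr (hb i)⟩
      · have hj : (j : ℕ) + 1 ≤ s₂ := (hmr _).mp hy
        by_cases hjs : (j : ℕ) + 1 = s₂
        · have : j = ⟨s₂ - 1, by omega⟩ := Fin.ext (by simp only; omega)
          rw [this, hA (by omega)]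
          exact Or.inr (Or.inr (Or.inl rfl))
        · rw [hc j hjs]
          exact Or.inr (Or.inl ⟨Fin.succ j, ⟨Nat.zero_le _, by rw [Fin.val_succ]; omega⟩, rfl⟩)
    · exact Subgroup.subset_closure (Or.inr (Or.inr (Or.inr rfl)))

end Literature.GroupTheory.CombinatorialGroupTheory.PuncturedSurfaceGroup

namespace Literature.AnabelianGeometry.SemiGraphs

namespace PSCDatum

open scoped Pointwise
open Multiplicative
open Literature.AnabelianGeometry.Anabelioids (IsSigmaInteger)
open Literature.GroupTheory.CombinatorialGroupTheory
open Literature.GroupTheory.CombinatorialGroupTheory.PuncturedSurfaceGroup (a b c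
  exists_freeGroupBasis_nodeLoop closure_chainFirst_eq closure_chainMid_unmarkedLast_eq
  nodeLoop_eq_inv_of_unmarked exists_hom_closedComponent c_ne_one comm_prod_ite_mem)
open Literature.GroupTheory.CombinatorialGroupTheory.FreeFactorFibredTwist (lift_apply_basis)
open SemiGraphOfAnabelioids (IsProSigmaCompletion)
open SemiGraphOfAnabelioids.IsProSigmaCompletion (freeFactor_exists_open_separating_sameVertex
  freeFactor_exists_open_separating_crossVertex cutoff_exists_open_separating_sameVertex
  exists_open_separating_of_hom)

variable {P : Type} [Group P] [TopologicalSpace P] [IsTopologicalGroup P]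
variable [CompactSpace P] [TotallyDisconnectedSpace P] {Sigma : Set ℕ} {g r : ℕ}

/-- **Row P12-L01-V / F-2826 (`VerticialSeparatingCoverings`, `V' := V`) at EVERY three-component chain datum
whose last component is UNMARKED** (`s₁ = 0 < s₂ < r`, `g₀ ≤ g₁ < g`, `C₀` stable).
[cite: MochizukiCombGC2007, Prop 1.2 proof p.9] -/
theorem verticialSeparatingCoverings_of_threeChain_unmarkedEnd (hne : Sigma.Nonempty)
    (hprime : ∀ p ∈ Sigma, p.Prime) (ι : PuncturedSurfaceGroup g r →* P)
    (hι : IsProSigmaCompletion Sigma ι) (G : PSCDatum P) {g₀ g₁ s₁ s₂ : ℕ} (hg : g₀ ≤ g₁) (hg₁ : g₁ < g)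
    (hs₁ : s₁ = 0) (hs₂ : 1 ≤ s₂) (hs₂r : s₂ < r) (hst₀ : 1 ≤ g₀ ∨ 2 ≤ r - s₂)
    (v₀ vm v₁ : G.graph.V) (hV : ∀ w, w = v₀ ∨ w = vm ∨ w = v₁) (εA η : PuncturedSurfaceGroup g r)
    (hεA : εA = ((List.finRange r).map fun j : Fin r =>
          if s₂ ≤ (j : ℕ) then PuncturedSurfaceGroup.c (g := g) j else 1).prod *
        ((List.finRange g).map fun i : Fin g => if (i : ℕ) < g₀ then
          PuncturedSurfaceGroup.a (r := r) i * PuncturedSurfaceGroup.b i *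
            (PuncturedSurfaceGroup.a i)⁻¹ * (PuncturedSurfaceGroup.b i)⁻¹ else 1).prod)
    (hη : η = ((List.finRange r).map fun j : Fin r =>
          if s₁ ≤ (j : ℕ) then PuncturedSurfaceGroup.c (g := g) j else 1).prod *
        ((List.finRange g).map fun i : Fin g => if (i : ℕ) < g₁ then
          PuncturedSurfaceGroup.a (r := r) i * PuncturedSurfaceGroup.b i *
            (PuncturedSurfaceGroup.a i)⁻¹ * (PuncturedSurfaceGroup.b i)⁻¹ else 1).prod)
    (hV₀ : G.vertGp v₀ = ((Subgroup.closure {x : PuncturedSurfaceGroup g r |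
        (∃ i : Fin g, (i : ℕ) < g₀ ∧ (x = PuncturedSurfaceGroup.a i ∨ x = PuncturedSurfaceGroup.b i)) ∨
        ∃ j : Fin r, s₂ ≤ (j : ℕ) ∧ x = PuncturedSurfaceGroup.c j}).map ι).topologicalClosure)
    (hVm : G.vertGp vm = ((Subgroup.closure {x : PuncturedSurfaceGroup g r |
        (∃ i : Fin g, (g₀ ≤ (i : ℕ) ∧ (i : ℕ) < g₁) ∧
          (x = PuncturedSurfaceGroup.a i ∨ x = PuncturedSurfaceGroup.b i)) ∨
        (∃ j : Fin r, (s₁ ≤ (j : ℕ) ∧ (j : ℕ) < s₂) ∧ x = PuncturedSurfaceGroup.c j) ∨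
        x = εA ∨ x = η}).map ι).topologicalClosure)
    (hV₁ : G.vertGp v₁ = ((Subgroup.closure {x : PuncturedSurfaceGroup g r |
        (∃ i : Fin g, g₁ ≤ (i : ℕ) ∧ (x = PuncturedSurfaceGroup.a i ∨ x = PuncturedSurfaceGroup.b i)) ∨
        (∃ j : Fin r, (j : ℕ) < s₁ ∧ x = PuncturedSurfaceGroup.c j) ∨ x = η}).map ι).topologicalClosure) :
    G.VerticialSeparatingCoverings := by
  classical
  subst hs₁
  obtain ⟨r', rfl⟩ : ∃ r', r = r' + 1 := ⟨r - 1, by omega⟩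
  obtain ⟨g₂, rfl⟩ : ∃ g₂, g = g₁ + g₂ := ⟨g - g₁, by omega⟩
  have hg₂ : 1 ≤ g₂ := by omega
  obtain ⟨ℓ, hℓS⟩ := hne
  have hℓ : ℓ.Prime := hprime ℓ hℓS
  have hSig : ∃ ℓ ∈ Sigma, ℓ.Prime := ⟨ℓ, hℓS, hℓ⟩
  -- the node-loop basis of `(g₀, s₂)`
  obtain ⟨bA, ha, hb, hc, hkA⟩ := exists_freeGroupBasis_nodeLoop (g₁ + g₂) r' g₀ s₂ hs₂ (by omega) εA hεA
  have hk : ∀ h : s₂ - 1 < r', bA (Sum.inr ⟨s₂ - 1, h⟩) = εA := fun _ => hkA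
  have hslot : s₂ - 1 < r' := by omega
  -- the three index sets
  obtain ⟨S₀, hS₀⟩ : ∃ S : Set ((Fin (g₁ + g₂) × Bool) ⊕ Fin r'),
      S = {x | Sum.elim (fun p : Fin (g₁ + g₂) × Bool => (p.1 : ℕ) < g₀) (fun j : Fin r' => s₂ ≤ (j : ℕ) + 1) x} :=
    ⟨_, rfl⟩
  obtain ⟨Sm, hSm⟩ : ∃ S : Set ((Fin (g₁ + g₂) × Bool) ⊕ Fin r'),
      S = {x | Sum.elim (fun p : Fin (g₁ + g₂) × Bool => g₀ ≤ (p.1 : ℕ) ∧ (p.1 : ℕ) < g₁)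
        (fun j : Fin r' => (j : ℕ) + 1 ≤ s₂) x} := ⟨_, rfl⟩
  obtain ⟨S₁, hS₁⟩ : ∃ S : Set ((Fin (g₁ + g₂) × Bool) ⊕ Fin r'),
      S = {x | Sum.elim (fun p : Fin (g₁ + g₂) × Bool => g₁ ≤ (p.1 : ℕ)) (fun _ : Fin r' => False) x} :=
    ⟨_, rfl⟩
  have h0l : ∀ p : Fin (g₁ + g₂) × Bool, (Sum.inl p : (Fin (g₁ + g₂) × Bool) ⊕ Fin r') ∈ S₀ ↔ (p.1 : ℕ) < g₀ :=
    fun _ => by rw [hS₀]; exact Iff.rfl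
  have h0r : ∀ j : Fin r', (Sum.inr j : (Fin (g₁ + g₂) × Bool) ⊕ Fin r') ∈ S₀ ↔ s₂ ≤ (j : ℕ) + 1 :=
    fun _ => by rw [hS₀]; exact Iff.rfl
  have hml : ∀ p : Fin (g₁ + g₂) × Bool, (Sum.inl p : (Fin (g₁ + g₂) × Bool) ⊕ Fin r') ∈ Sm ↔
      g₀ ≤ (p.1 : ℕ) ∧ (p.1 : ℕ) < g₁ := fun _ => by rw [hSm]; exact Iff.rfl
  have hmr : ∀ j : Fin r', (Sum.inr j : (Fin (g₁ + g₂) × Bool) ⊕ Fin r') ∈ Sm ↔ (j : ℕ) + 1 ≤ s₂ :=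
    fun _ => by rw [hSm]; exact Iff.rfl
  have h1l : ∀ p : Fin (g₁ + g₂) × Bool, (Sum.inl p : (Fin (g₁ + g₂) × Bool) ⊕ Fin r') ∈ S₁ ↔ g₁ ≤ (p.1 : ℕ) :=
    fun _ => by rw [hS₁]; exact Iff.rfl
  have h1r : ∀ j : Fin r', (Sum.inr j : (Fin (g₁ + g₂) × Bool) ⊕ Fin r') ∉ S₁ := fun _ h => by
    rw [hS₁] at h; exact h
  -- `η` is the inverse of the handle product of `C₁`; `η ≠ 1`
  have hηinv := nodeLoop_eq_inv_of_unmarked (g := g₁ + g₂) (r := r' + 1) g₁ η hη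
  have hη1 : η ≠ 1 := by
    obtain ⟨θ, hθinj, -, -, hθc, -⟩ := exists_hom_closedComponent (g₀ := g₁) (g₁ := g₂) (r' := r') η hη
    rw [← hθc, ← map_one θ]
    intro h
    exact c_ne_one (by unfold PuncturedSurfaceGroup.IsHyperbolicType; omega) 0 (hθinj h)
  have hηmem : η ∈ Subgroup.closure (bA '' {y | y ∉ S₀ ∧ y ∉ Sm}) := by
    rw [hηinv]
    refine Subgroup.inv_mem _ (comm_prod_ite_mem _ _ (fun i hi => ?_) (fun i hi => ?_))
    · rw [← ha i]
      exact Subgroup.subset_closure ⟨_, ⟨fun h => by have := (h0l _).mp h; simp only at this; omega,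
        fun h => by have := (hml _).mp h; simp only at this; omega⟩, rfl⟩
    · rw [← hb i]
      exact Subgroup.subset_closure ⟨_, ⟨fun h => by have := (h0l _).mp h; simp only at this; omega,
        fun h => by have := (hml _).mp h; simp only at this; omega⟩, rfl⟩
  -- the three vertex groups
  have hA₀ : G.vertGp v₀ = ((Subgroup.closure (bA '' S₀)).map ι).topologicalClosure := by
    rw [hV₀, hS₀, closure_chainFirst_eq (s₁ := 0) hεA ha hb (fun j _ h2 => hc j h2) hk (by omega) (by omega)]
  have hAm : G.vertGp vm = ((Subgroup.closure (bA '' Sm ∪ {η})).map ι).topologicalClosure := by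
    rw [hVm, hSm, closure_chainMid_unmarkedLast_eq hεA hη ha hb hc hk hg hs₂ (by omega)]
  have hA₁ : G.vertGp v₁ = ((Subgroup.closure (bA '' S₁)).map ι).topologicalClosure := by
    rw [hV₁]
    congr 2
    apply le_antisymm
    · rw [Subgroup.closure_le]
      rintro x (⟨i, hi, rfl | rfl⟩ | ⟨j, hj, -⟩ | rfl)
      · exact Subgroup.subset_closure ⟨Sum.inl (i, false), (h1l _).mpr hi, ha i⟩
      · exact Subgroup.subset_closure ⟨Sum.inl (i, true), (h1l _).mpr hi, hb i⟩
      · exact absurd hj (Nat.not_lt_zero _)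
      · rw [hηinv]
        refine Subgroup.inv_mem _ (comm_prod_ite_mem _ _ (fun i hi => ?_) (fun i hi => ?_))
        · rw [← ha i]; exact Subgroup.subset_closure ⟨_, (h1l _).mpr hi, rfl⟩
        · rw [← hb i]; exact Subgroup.subset_closure ⟨_, (h1l _).mpr hi, rfl⟩
    · rw [Subgroup.closure_le]
      rintro _ ⟨y, hy, rfl⟩
      apply Subgroup.subset_closure
      rcases y with ⟨i, _ | _⟩ | j
      · exact Or.inl ⟨i, (h1l _).mp hy, Or.inl (ha i)⟩
      · exact Or.inl ⟨i, (h1l _).mp hy, Or.inr (hb i)⟩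
      · exact absurd hy (h1r j)
  -- membership helpers
  have hcl : ∀ (S : Set ((Fin (g₁ + g₂) × Bool) ⊕ Fin r')) (T : Set (PuncturedSurfaceGroup (g₁ + g₂) (r' + 1)))
      (y), y ∈ S → ι (bA y) ∈ ((Subgroup.closure (bA '' S ∪ T)).map ι).topologicalClosure := fun S T y hy =>
    Subgroup.le_topologicalClosure _ (Subgroup.mem_map_of_mem ι (Subgroup.subset_closure (Or.inl ⟨y, hy, rfl⟩)))
  have hcl' : ∀ (S : Set ((Fin (g₁ + g₂) × Bool) ⊕ Fin r')) (y), y ∈ S →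
      ι (bA y) ∈ ((Subgroup.closure (bA '' S)).map ι).topologicalClosure := fun S y hy =>
    Subgroup.le_topologicalClosure _ (Subgroup.mem_map_of_mem ι (Subgroup.subset_closure ⟨y, hy, rfl⟩))
  have hτA0 : (Sum.inr ⟨s₂ - 1, hslot⟩ : (Fin (g₁ + g₂) × Bool) ⊕ Fin r') ∈ S₀ := (h0r _).mpr (by simp only; omega)
  have hτAm : (Sum.inr ⟨s₂ - 1, hslot⟩ : (Fin (g₁ + g₂) × Bool) ⊕ Fin r') ∈ Sm := (hmr _).mpr (by simp only; omega)
  have hτA1 : (Sum.inr ⟨s₂ - 1, hslot⟩ : (Fin (g₁ + g₂) × Bool) ⊕ Fin r') ∉ S₁ := h1r _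
  have hκ1 : (Sum.inl (⟨g₁, by omega⟩, false) : (Fin (g₁ + g₂) × Bool) ⊕ Fin r') ∈ S₁ := (h1l _).mpr le_rfl
  have hκ0 : (Sum.inl (⟨g₁, by omega⟩, false) : (Fin (g₁ + g₂) × Bool) ⊕ Fin r') ∉ S₀ := fun h => by
    have := (h0l _).mp h; simp only at this; omega
  have hκm : (Sum.inl (⟨g₁, by omega⟩, false) : (Fin (g₁ + g₂) × Bool) ⊕ Fin r') ∉ Sm := fun h => by
    have := (hml _).mp h; simp only at this; omega
  -- a letter of `C₀` outside `Sm` and `S₁` (stability of `C₀`)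
  obtain ⟨x₀, hx₀0, hx₀m, hx₀1⟩ : ∃ x, x ∈ S₀ ∧ x ∉ Sm ∧ x ∉ S₁ := by
    rcases hst₀ with h | h
    · exact ⟨Sum.inl (⟨0, by omega⟩, false), (h0l _).mpr (by simp only; omega),
        fun h' => by have := (hml _).mp h'; simp only at this; omega,
        fun h' => by have := (h1l _).mp h'; simp only at this; omega⟩
    · exact ⟨Sum.inr ⟨s₂, by omega⟩, (h0r _).mpr (by simp only; omega),
        fun h' => by have := (hmr _).mp h'; simp only at this; omega, h1r _⟩
  -- the free-factor projections killing `S₀`, `S₁`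
  let ρ₀ : PuncturedSurfaceGroup (g₁ + g₂) (r' + 1) →* PuncturedSurfaceGroup (g₁ + g₂) (r' + 1) :=
    bA.lift fun y => if y ∈ S₀ then 1 else bA y
  have hρ₀ : ∀ y, ρ₀ (bA y) = if y ∈ S₀ then 1 else bA y := fun y => lift_apply_basis bA _ y
  let ρ₁ : PuncturedSurfaceGroup (g₁ + g₂) (r' + 1) →* PuncturedSurfaceGroup (g₁ + g₂) (r' + 1) :=
    bA.lift fun y => if y ∈ S₁ then 1 else bA y
  have hρ₁ : ∀ y, ρ₁ (bA y) = if y ∈ S₁ then 1 else bA y := fun y => lift_apply_basis bA _ y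
  have hρ₀η : ρ₀ η ≠ 1 := by
    have hfix : Subgroup.closure (bA '' {y | y ∉ S₀ ∧ y ∉ Sm}) ≤ ρ₀.eqLocus (MonoidHom.id _) := by
      rw [Subgroup.closure_le]
      rintro _ ⟨y, hy, rfl⟩
      change ρ₀ (bA y) = bA y
      rw [hρ₀, if_neg hy.1]
    have h := hfix hηmem
    change ρ₀ η = η at h
    rw [h]
    exact hη1
  refine G.verticialSeparatingCoverings_of_sameVertex_of_crossVertex (fun V hVn hVo v γ₁ γ₂ hne => ?_)
    (fun V hVn hVo w₁ w₂ γ₁ γ₂ h12 => ?_)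
  · -- same vertex
    haveI := hVn
    rcases hV v with rfl | rfl | rfl
    · exact freeFactor_exists_open_separating_sameVertex hι bA S₀ ⟨_, hτA0⟩ hℓ hℓS (G.vertGp v) hA₀ V hVo γ₁ γ₂
        hne
    · -- the middle vertex: cut-off twist with `Ψ = ε_A^∨`
      let Ψ : PuncturedSurfaceGroup (g₁ + g₂) (r' + 1) →* Multiplicative ℤ :=
        bA.lift fun y => if y = Sum.inr ⟨s₂ - 1, hslot⟩ then ofAdd 1 else 1
      have hΨ : ∀ y, Ψ (bA y) = if y = Sum.inr ⟨s₂ - 1, hslot⟩ then ofAdd 1 else 1 := fun y =>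
        lift_apply_basis bA _ y
      refine cutoff_exists_open_separating_sameVertex hι bA Sm Ψ (fun y hy => ?_) {η} ?_ _ rfl hτAm ?_ hℓ hℓS
        (G.vertGp v) hAm V hVo γ₁ γ₂ hne
      · rw [hΨ, if_neg (fun h => hy (by rw [h]; exact hτAm))]
      · rw [Set.singleton_subset_iff]
        refine Subgroup.closure_mono (Set.image_mono fun y hy => ?_) hηmem
        exact fun h => absurd h hy.2
      · rw [hΨ, if_pos rfl]
        exact fun h => one_ne_zero (Multiplicative.ofAdd.injective (h.trans ofAdd_zero.symm))
    · exact freeFactor_exists_open_separating_sameVertex hι bA S₁ ⟨_, hκ1⟩ hℓ hℓS (G.vertGp v) hA₁ V hVo γ₁ γ₂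
        hne
  · -- different vertices
    haveI := hVn
    have hVi : IsSigmaInteger Sigma V.index := hι.index_open V hVn hVo
    have hmpos : 0 < V.index := hVi.1
    have hmlt : V.index < ℓ ^ V.index := Nat.lt_pow_self hℓ.one_lt
    haveI : NeZero (ℓ ^ V.index) := ⟨pow_ne_zero _ hℓ.ne_zero⟩
    have hZM : IsSigmaInteger Sigma (Nat.card (Multiplicative (ZMod (ℓ ^ V.index)))) := by
      rw [show Nat.card (Multiplicative (ZMod (ℓ ^ V.index))) = ℓ ^ V.index from Nat.card_zmod _]
      exact Literature.AnabelianGeometry.SemiGraphs.isSigmaInteger_prime_pow hℓ hℓS _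
    have hpow1 : (ofAdd (1 : ZMod (ℓ ^ V.index))) ^ V.index ≠ 1 := by
      rw [← ofAdd_nsmul, nsmul_eq_mul, mul_one, Ne, ofAdd_eq_one, ZMod.natCast_eq_zero_iff]
      exact fun h => absurd (Nat.le_of_dvd hmpos h) (not_le.mpr hmlt)
    -- a character dual to a letter `y₀ ∉ Sm` kills `Π_{v_mid}`
    have hkillm : ∀ (y₀ : (Fin (g₁ + g₂) × Bool) ⊕ Fin r'), y₀ ∉ Sm →
        ∃ χ : PuncturedSurfaceGroup (g₁ + g₂) (r' + 1) →* Multiplicative (ZMod (ℓ ^ V.index)),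
          χ (bA y₀) = ofAdd 1 ∧ ∀ x ∈ Subgroup.closure (bA '' Sm ∪ {η}), χ x = 1 := by
      intro y₀ hy₀
      let χ : PuncturedSurfaceGroup (g₁ + g₂) (r' + 1) →* Multiplicative (ZMod (ℓ ^ V.index)) :=
        bA.lift fun y => if y = y₀ then ofAdd 1 else 1
      have hχ : ∀ y, χ (bA y) = if y = y₀ then ofAdd 1 else 1 := fun y => lift_apply_basis bA _ y
      refine ⟨χ, by rw [hχ, if_pos rfl], fun x hx => ?_⟩
      refine (Subgroup.closure_le (K := χ.ker)).mpr ?_ hx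
      rintro z (⟨y, hy, rfl⟩ | rfl)
      · rw [SetLike.mem_coe, MonoidHom.mem_ker, hχ, if_neg (fun h : y = y₀ => hy₀ (by rw [← h]; exact hy))]
      · rw [SetLike.mem_coe, MonoidHom.mem_ker, hηinv, map_inv, inv_eq_one, map_list_prod, List.map_map]
        refine List.prod_eq_one fun w hw => ?_
        obtain ⟨i, -, rfl⟩ := List.mem_map.mp hw
        simp only [Function.comp_apply, apply_ite χ, map_one, map_mul, map_inv, mul_inv_cancel_comm,
          mul_inv_cancel, ite_self]
    by_cases h2 : w₂ = vm
    · -- killed: the middle vertex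
      rw [h2] at h12 ⊢
      rcases hV w₁ with h1 | h1 | h1
      · obtain ⟨χ, hχ1, hχ0⟩ := hkillm x₀ hx₀m
        exact exists_open_separating_of_hom hι hZM χ (G.vertGp vm) _ hAm hχ0 (G.vertGp w₁) (bA x₀)
          (by rw [h1, hA₀]; exact hcl' S₀ x₀ hx₀0) V hVo (by rw [hχ1]; exact hpow1) γ₁ γ₂
      · exact absurd h1 h12
      · obtain ⟨χ, hχ1, hχ0⟩ := hkillm _ hκm
        exact exists_open_separating_of_hom hι hZM χ (G.vertGp vm) _ hAm hχ0 (G.vertGp w₁) (bA _)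
          (by rw [h1, hA₁]; exact hcl' S₁ _ hκ1) V hVo (by rw [hχ1]; exact hpow1) γ₁ γ₂
    · by_cases h2' : w₂ = v₀
      · -- killed: `v₀` (free factor `S₀`); witnesses `η` (alive `v_mid`), `a_{g₁}` (alive `v₁`)
        rw [h2'] at h12 h2 ⊢
        rcases hV w₁ with h1 | h1 | h1
        · exact absurd h1 h12
        · refine freeFactor_exists_open_separating_crossVertex hι hSig bA S₀ ρ₀ hρ₀ (G.vertGp v₀) hA₀
            (G.vertGp w₁) η ?_ hρ₀η V hVo γ₁ γ₂
          rw [h1, hAm]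
          exact Subgroup.le_topologicalClosure _
            (Subgroup.mem_map_of_mem ι (Subgroup.subset_closure (Or.inr rfl)))
        · refine freeFactor_exists_open_separating_crossVertex hι hSig bA S₀ ρ₀ hρ₀ (G.vertGp v₀) hA₀
            (G.vertGp w₁) (bA (Sum.inl (⟨g₁, by omega⟩, false))) (by rw [h1, hA₁]; exact hcl' S₁ _ hκ1) ?_
            V hVo γ₁ γ₂
          rw [hρ₀, if_neg hκ0]
          exact FreeGroupBasis.apply_ne_one _ _
      · -- killed: `v₁` (free factor `S₁`); witness `ε_A` (alive `v₀` or `v_mid`)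
        have hw₂ : w₂ = v₁ := by
          rcases hV w₂ with h | h | h
          · exact absurd h h2'
          · exact absurd h h2
          · exact h
        rw [hw₂] at h12 ⊢
        have hρε : ρ₁ (bA (Sum.inr ⟨s₂ - 1, hslot⟩)) ≠ 1 := by
          rw [hρ₁, if_neg hτA1]; exact FreeGroupBasis.apply_ne_one _ _
        rcases hV w₁ with h1 | h1 | h1
        · exact freeFactor_exists_open_separating_crossVertex hι hSig bA S₁ ρ₁ hρ₁ (G.vertGp v₁) hA₁
            (G.vertGp w₁) _ (by rw [h1, hA₀]; exact hcl' S₀ _ hτA0) hρε V hVo γ₁ γ₂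
        · exact freeFactor_exists_open_separating_crossVertex hι hSig bA S₁ ρ₁ hρ₁ (G.vertGp v₁) hA₁
            (G.vertGp w₁) _ (by rw [h1, hAm]; exact hcl Sm {η} _ hτAm) hρε V hVo γ₁ γ₂
        · exact absurd h1 h12

end PSCDatum

end Literature.AnabelianGeometry.SemiGraphs

end
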